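import Summits.QuantumFields.YangMills.Theorems.ColdStartUniversalityLatticeLangevinFrameCalculus
import Mathlib.MeasureTheory.Integral.Bochner.Basic
import HarnessLib

/-!
# Route `ColdStartUniversality` (fixed-cut-off package, Bakry–Émery side): the INTEGRATED BOCHNER FORMULA for a frame generator
# `𝓛 = Σ_n W_n² + (W_nψ) W_n` under an abstract integration-by-parts hypothesis

Helper file (seat `ym-line-csu-p1`, g25; `--supports stmt-QuantumFields-24809`).  Abstract setting: a real normed space `E`, a finite
frame of continuous LINEAR vector fields `s : ι → E →L[ℝ] E` closing under brackets with a structure tensor antisymmetric in its last two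
slots (`FrameCalculus`), a potential `ψ : E → ℝ`, and a measure `ν` on a space `X` read through a map `co : X → E` (in the sequel:
the Wilson measure `μ_{β'}` of the SU(2) lattice Langevin dynamics of Shen–Zhu–Zhu read through the real link coordinates) satisfying the
INTEGRATION-BY-PARTS identity `∫ (W_nA) B dν = −∫ A (W_nB) dν − ∫ A B (W_nψ) dν` for `C¹` `A, B` (hypothesis `hIBP`; for `μ_{β'}` it is
Haar invariance, sequel file).  Writing `W_n f (y) = Df(y)[s_n y]` and `𝓛f = Σ_n (W_nW_n f + W_nψ · W_n f)`:

* ★ `integral_frameGen_mul_eq_neg_sum` — `∫ (𝓛A) B dν = −Σ_n ∫ W_nA · W_nB dν` (`A ∈ C²`, `B ∈ C¹`): symmetry and the Dirichlet form;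
* ★★ `integral_frameGen_sq_eq` — the INTEGRATED BOCHNER FORMULA (`g ∈ C³`, `ψ ∈ C²`):
    `∫ (𝓛g)² dν = Σ_{n,m} ∫ (W_mW_n g)² dν − Σ_{n,m} ∫ W_ng · W_mg · W_nW_mψ dν`,
  i.e. `∫ (𝓛g)² = ∫ Γ₂(g)` with Bochner's `Γ₂ = ‖∇²g‖² + (Ric − Hess ψ)(∇g,∇g)`, the Ricci term being hidden in the antisymmetric part of
  `(W_mW_ng)` (`quarter_sum_sum_sq_bracket_le`) and the two commutator corrections vanishing by `FrameCalculus` Cancellations I–II.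
This is the integrated `Γ₂`-identity behind the Bakry–Émery criterion (Bakry–Émery 1985; Bakry–Gentil–Ledoux 2014, (1.16.3), Thm 4.8.4 /
Prop. 5.7.1 «`CD(ρ,∞) ⇒` Poincaré / log-Sobolev»), here for frames rather than coordinates.
THEOREMS ONLY, no definition, no sorry; [folklore].  HONEST FRAMING: abstract calculus; no statement about Yang–Mills; nothing K-uniform;
the YM mass gap is NOT proved.
-/

set_option autoImplicit false

noncomputable section

namespace Summit.QuantumFields.YangMills.Theorems.ColdStartUniversality

open Finset MeasureTheory
open scoped BigOperators

variable {E : Type*} [NormedAddCommGroup E] [NormedSpace ℝ E]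
variable {X : Type*} [MeasurableSpace X]
variable {ι : Type*} [Fintype ι]

/-! ## §1. Small calculus complements -/

/-- Frame derivative of a finite sum of differentiable functions. [folklore] -/
theorem frameDeriv_sum {J : Type*} (S : Finset J) {f : J → E → ℝ} {y : E}
    (hf : ∀ k ∈ S, DifferentiableAt ℝ (f k) y) (v : E) :
    fderiv ℝ (fun z => ∑ k ∈ S, f k z) y v = ∑ k ∈ S, fderiv ℝ (f k) y v := by
  have h := fderiv_sum_mul_apply S (fun _ => (1 : ℝ)) hf v
  simp only [one_mul] at h
  exact h

/-- Continuity of a frame derivative of a `C¹` function. [folklore] -/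
theorem continuous_frameDeriv {g : E → ℝ} (hg : ContDiff ℝ 1 g) (s : E →L[ℝ] E) :
    Continuous (fun z => fderiv ℝ g z (s z)) :=
  (contDiff_frameDeriv (k := 0) hg s).continuous

/-- The frame generator `𝓛A = Σ_n (W_nW_nA + W_nψ·W_nA)` of a `C²` function is `C⁰`, of a `C³` function is `C¹`. [folklore] -/
theorem contDiff_frameGen {A ψ : E → ℝ} {k : ℕ} (hA : ContDiff ℝ (k + 2) A) (hψ : ContDiff ℝ (k + 1) ψ)
    (s : ι → E →L[ℝ] E) :
    ContDiff ℝ k (fun z => ∑ n, (fderiv ℝ (fun w => fderiv ℝ A w (s n w)) z (s n z) +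
      fderiv ℝ ψ z (s n z) * fderiv ℝ A z (s n z))) := by
  refine ContDiff.sum fun n _ => ?_
  have h1 : ContDiff ℝ (k + 1) (fun w => fderiv ℝ A w (s n w)) :=
    contDiff_frameDeriv (k := k + 1) (by simpa [add_assoc, one_add_one_eq_two] using hA) (s n)
  have h2 : ContDiff ℝ k (fun z => fderiv ℝ (fun w => fderiv ℝ A w (s n w)) z (s n z)) :=
    contDiff_frameDeriv (k := k) h1 (s n)
  have h3 : ContDiff ℝ k (fun z => fderiv ℝ ψ z (s n z)) := contDiff_frameDeriv (k := k) hψ (s n)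
  have h4 : ContDiff ℝ k (fun z => fderiv ℝ A z (s n z)) :=
    (contDiff_frameDeriv (k := k + 1) (by simpa [add_assoc, one_add_one_eq_two] using hA) (s n)).of_le (by simp)
  exact h2.add (h3.mul h4)

/-! ## §2. Symmetry: `∫ (𝓛A) B = −Σ_n ∫ W_nA W_nB` -/

/-- ★ **The frame generator against a test function** (`A ∈ C²`, `B ∈ C¹`): under the integration-by-parts hypothesis,
`∫ (𝓛A)(co x) B(co x) dν = −Σ_n ∫ W_nA · W_nB dν` — the drift terms `W_nψ · W_nA · B` cancel exactly against the density
corrections of the second-order terms.  (Bakry–Gentil–Ledoux (1.16.3)/(3.1.1): `∫ f 𝓛g dμ = −∫ Γ(f,g) dμ`.) [folklore] -/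
theorem integral_frameGen_mul_eq_neg_sum (ν : Measure X) (co : X → E) (s : ι → E →L[ℝ] E) (ψ : E → ℝ)
    (hint : ∀ F : E → ℝ, Continuous F → Integrable (fun x => F (co x)) ν)
    (hIBP : ∀ (n : ι) (A B : E → ℝ), ContDiff ℝ 1 A → ContDiff ℝ 1 B →
      ∫ x, fderiv ℝ A (co x) (s n (co x)) * B (co x) ∂ν =
        -∫ x, A (co x) * fderiv ℝ B (co x) (s n (co x)) ∂ν -
          ∫ x, A (co x) * B (co x) * fderiv ℝ ψ (co x) (s n (co x)) ∂ν)
    (hψ : ContDiff ℝ 1 ψ) {A B : E → ℝ} (hA : ContDiff ℝ 2 A) (hB : ContDiff ℝ 1 B) :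
    ∫ x, (∑ n, (fderiv ℝ (fun w => fderiv ℝ A w (s n w)) (co x) (s n (co x)) +
        fderiv ℝ ψ (co x) (s n (co x)) * fderiv ℝ A (co x) (s n (co x)))) * B (co x) ∂ν =
      -∑ n, ∫ x, fderiv ℝ A (co x) (s n (co x)) * fderiv ℝ B (co x) (s n (co x)) ∂ν := by
  have hA1 : ∀ n, ContDiff ℝ 1 (fun w => fderiv ℝ A w (s n w)) := fun n => contDiff_frameDeriv (k := 1) hA (s n)
  -- continuity of the pieces
  have hcA : ∀ n, Continuous (fun z => fderiv ℝ A z (s n z)) := fun n => (hA1 n).continuous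
  have hcAA : ∀ n, Continuous (fun z => fderiv ℝ (fun w => fderiv ℝ A w (s n w)) z (s n z)) :=
    fun n => continuous_frameDeriv (hA1 n) (s n)
  have hcψ : ∀ n, Continuous (fun z => fderiv ℝ ψ z (s n z)) := fun n => continuous_frameDeriv hψ (s n)
  have hcB : Continuous B := hB.continuous
  have hcB' : ∀ n, Continuous (fun z => fderiv ℝ B z (s n z)) := fun n => continuous_frameDeriv hB (s n)
  -- expand the sum
  have hsum : ∫ x, (∑ n, (fderiv ℝ (fun w => fderiv ℝ A w (s n w)) (co x) (s n (co x)) +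
        fderiv ℝ ψ (co x) (s n (co x)) * fderiv ℝ A (co x) (s n (co x)))) * B (co x) ∂ν =
      ∑ n, (∫ x, fderiv ℝ (fun w => fderiv ℝ A w (s n w)) (co x) (s n (co x)) * B (co x) ∂ν +
        ∫ x, fderiv ℝ A (co x) (s n (co x)) * B (co x) * fderiv ℝ ψ (co x) (s n (co x)) ∂ν) := by
    have h1 : ∀ x, (∑ n, (fderiv ℝ (fun w => fderiv ℝ A w (s n w)) (co x) (s n (co x)) +
        fderiv ℝ ψ (co x) (s n (co x)) * fderiv ℝ A (co x) (s n (co x)))) * B (co x) =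
        ∑ n, (fderiv ℝ (fun w => fderiv ℝ A w (s n w)) (co x) (s n (co x)) * B (co x) +
          fderiv ℝ A (co x) (s n (co x)) * B (co x) * fderiv ℝ ψ (co x) (s n (co x))) := by
      intro x; rw [Finset.sum_mul]; refine Finset.sum_congr rfl fun n _ => ?_; ring
    simp_rw [h1]
    rw [integral_finsetSum _ fun n _ => ?_]
    · refine Finset.sum_congr rfl fun n _ => ?_
      exact integral_add (hint _ ((hcAA n).mul hcB)) (hint _ (((hcA n).mul hcB).mul (hcψ n)))
    · exact (hint _ ((hcAA n).mul hcB)).add (hint _ (((hcA n).mul hcB).mul (hcψ n)))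
  rw [hsum, ← Finset.sum_neg_distrib]
  refine Finset.sum_congr rfl fun n _ => ?_
  rw [hIBP n _ B (hA1 n) hB]
  ring

/-! ## §3. The integrated Bochner formula -/

/-- ★★ **Integrated Bochner formula for a frame generator.**  For a frame `s` with bracket relation
`s_m(s_n y) − s_n(s_m y) = Σ_k c_{nmk} s_k y`, `c` antisymmetric in its last two slots, a `C²` potential `ψ`, a measure satisfying
the integration-by-parts hypothesis, and `g ∈ C³`:
`∫ (𝓛g)² dν = Σ_{n,m} ∫ (W_mW_n g)² dν − Σ_{n,m} ∫ W_ng · W_mg · W_nW_mψ dν`.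
(Bakry–Émery's `∫ (Lg)² dμ = ∫ Γ₂(g) dμ` with Bochner's formula for `Γ₂` on a Lie group with right-invariant frame; Bakry–Gentil–Ledoux
2014 (C.5.3)/(3.3.1).) [folklore] -/
theorem integral_frameGen_sq_eq (ν : Measure X) (co : X → E) (s : ι → E →L[ℝ] E) (ψ : E → ℝ)
    (c : ι → ι → ι → ℝ) (hs : ∀ n m y, s m (s n y) - s n (s m y) = ∑ k, c n m k • s k y)
    (hc : ∀ n m k, c n m k = -c n k m)
    (hint : ∀ F : E → ℝ, Continuous F → Integrable (fun x => F (co x)) ν)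
    (hIBP : ∀ (n : ι) (A B : E → ℝ), ContDiff ℝ 1 A → ContDiff ℝ 1 B →
      ∫ x, fderiv ℝ A (co x) (s n (co x)) * B (co x) ∂ν =
        -∫ x, A (co x) * fderiv ℝ B (co x) (s n (co x)) ∂ν -
          ∫ x, A (co x) * B (co x) * fderiv ℝ ψ (co x) (s n (co x)) ∂ν)
    (hψ : ContDiff ℝ 2 ψ) {g : E → ℝ} (hg : ContDiff ℝ 3 g) :
    ∫ x, (∑ n, (fderiv ℝ (fun w => fderiv ℝ g w (s n w)) (co x) (s n (co x)) +
        fderiv ℝ ψ (co x) (s n (co x)) * fderiv ℝ g (co x) (s n (co x)))) ^ 2 ∂ν =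
      ∑ n, ∑ m, ∫ x, (fderiv ℝ (fun z => fderiv ℝ g z (s n z)) (co x) (s m (co x))) ^ 2 ∂ν -
        ∑ n, ∑ m, ∫ x, fderiv ℝ g (co x) (s n (co x)) * fderiv ℝ g (co x) (s m (co x)) *
          fderiv ℝ (fun z => fderiv ℝ ψ z (s m z)) (co x) (s n (co x)) ∂ν := by
  have hg2 : ContDiff ℝ 2 g := hg.of_le (by norm_num)
  have hψ1 : ContDiff ℝ 1 ψ := hψ.of_le (by norm_num)
  -- regularity of the pieces
  have hWg2 : ∀ n, ContDiff ℝ 2 (fun w => fderiv ℝ g w (s n w)) := fun n => contDiff_frameDeriv (k := 2) hg (s n)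
  have hWWg1 : ∀ n m, ContDiff ℝ 1 (fun z => fderiv ℝ (fun w => fderiv ℝ g w (s n w)) z (s m z)) :=
    fun n m => contDiff_frameDeriv (k := 1) (hWg2 n) (s m)
  have hWψ1 : ∀ n, ContDiff ℝ 1 (fun w => fderiv ℝ ψ w (s n w)) := fun n => contDiff_frameDeriv (k := 1) hψ (s n)
  have hL1 : ContDiff ℝ 1 (fun z => ∑ n, (fderiv ℝ (fun w => fderiv ℝ g w (s n w)) z (s n z) +
      fderiv ℝ ψ z (s n z) * fderiv ℝ g z (s n z))) := contDiff_frameGen (k := 1) hg hψ s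
  -- continuity of everything in sight
  have cWg : ∀ n, Continuous (fun z => fderiv ℝ g z (s n z)) := fun n => (hWg2 n).continuous
  have cWWg : ∀ n m, Continuous (fun z => fderiv ℝ (fun w => fderiv ℝ g w (s n w)) z (s m z)) :=
    fun n m => (hWWg1 n m).continuous
  have cWWWg : ∀ n m k, Continuous
      (fun z => fderiv ℝ (fun z' => fderiv ℝ (fun w => fderiv ℝ g w (s n w)) z' (s m z')) z (s k z)) :=
    fun n m k => continuous_frameDeriv (hWWg1 n m) (s k)
  have cWψ : ∀ n, Continuous (fun z => fderiv ℝ ψ z (s n z)) := fun n => (hWψ1 n).continuous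
  have cWWψ : ∀ n m, Continuous (fun z => fderiv ℝ (fun w => fderiv ℝ ψ w (s n w)) z (s m z)) :=
    fun n m => continuous_frameDeriv (hWψ1 n) (s m)
  have cL : Continuous (fun z => ∑ n, (fderiv ℝ (fun w => fderiv ℝ g w (s n w)) z (s n z) +
      fderiv ℝ ψ z (s n z) * fderiv ℝ g z (s n z))) := hL1.continuous
  -- Step 1: `∫ (𝓛g)² = -Σ_n ∫ W_ng · W_n(𝓛g)`
  have step1 := integral_frameGen_mul_eq_neg_sum ν co s ψ hint hIBP hψ1 hg2 hL1
  have hsq : ∀ x, (∑ n, (fderiv ℝ (fun w => fderiv ℝ g w (s n w)) (co x) (s n (co x)) +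
        fderiv ℝ ψ (co x) (s n (co x)) * fderiv ℝ g (co x) (s n (co x)))) ^ 2 =
      (∑ n, (fderiv ℝ (fun w => fderiv ℝ g w (s n w)) (co x) (s n (co x)) +
        fderiv ℝ ψ (co x) (s n (co x)) * fderiv ℝ g (co x) (s n (co x)))) *
      (fun z => ∑ n, (fderiv ℝ (fun w => fderiv ℝ g w (s n w)) z (s n z) +
        fderiv ℝ ψ z (s n z) * fderiv ℝ g z (s n z))) (co x) := fun x => by rw [sq]
  simp_rw [hsq]
  rw [step1]
  -- Step 2: expand `W_n (𝓛g)` pointwise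
  have step2 : ∀ n y, fderiv ℝ (fun z => ∑ m, (fderiv ℝ (fun w => fderiv ℝ g w (s m w)) z (s m z) +
      fderiv ℝ ψ z (s m z) * fderiv ℝ g z (s m z))) y (s n y) =
      ∑ m, (fderiv ℝ (fun z => fderiv ℝ (fun w => fderiv ℝ g w (s m w)) z (s m z)) y (s n y) +
        (fderiv ℝ ψ y (s m y) * fderiv ℝ (fun z => fderiv ℝ g z (s m z)) y (s n y) +
          fderiv ℝ g y (s m y) * fderiv ℝ (fun z => fderiv ℝ ψ z (s m z)) y (s n y))) := by
    intro n y
    have hd1 : ∀ m, DifferentiableAt ℝ (fun z => fderiv ℝ (fun w => fderiv ℝ g w (s m w)) z (s m z)) y :=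
      fun m => ((hWWg1 m m).differentiable (by norm_num)).differentiableAt
    have hd2 : ∀ m, DifferentiableAt ℝ (fun z => fderiv ℝ ψ z (s m z)) y :=
      fun m => ((hWψ1 m).differentiable (by norm_num)).differentiableAt
    have hd3 : ∀ m, DifferentiableAt ℝ (fun z => fderiv ℝ g z (s m z)) y :=
      fun m => ((hWg2 m).differentiable (by norm_num)).differentiableAt
    have hd23 : ∀ m, DifferentiableAt ℝ (fun z => fderiv ℝ ψ z (s m z) * fderiv ℝ g z (s m z)) y :=
      fun m => (hd2 m).mul (hd3 m)
    have hd4 : ∀ m, DifferentiableAt ℝ (fun z => fderiv ℝ (fun w => fderiv ℝ g w (s m w)) z (s m z) +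
        fderiv ℝ ψ z (s m z) * fderiv ℝ g z (s m z)) y := fun m => (hd1 m).add (hd23 m)
    rw [frameDeriv_sum Finset.univ (f := fun m z => fderiv ℝ (fun w => fderiv ℝ g w (s m w)) z (s m z) +
        fderiv ℝ ψ z (s m z) * fderiv ℝ g z (s m z)) (fun m _ => hd4 m)]
    refine Finset.sum_congr rfl fun m _ => ?_
    rw [fderiv_fun_add (hd1 m) (hd23 m), add_apply, fderiv_mul_apply_dir (hd2 m) (hd3 m)]
  simp_rw [step2]
  -- Step 3: distribute `W_ng ·` and the integral over the three groups of terms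
  have step3 : ∀ n, ∫ x, fderiv ℝ g (co x) (s n (co x)) *
      ∑ m, (fderiv ℝ (fun z => fderiv ℝ (fun w => fderiv ℝ g w (s m w)) z (s m z)) (co x) (s n (co x)) +
        (fderiv ℝ ψ (co x) (s m (co x)) * fderiv ℝ (fun z => fderiv ℝ g z (s m z)) (co x) (s n (co x)) +
          fderiv ℝ g (co x) (s m (co x)) * fderiv ℝ (fun z => fderiv ℝ ψ z (s m z)) (co x) (s n (co x)))) ∂ν =
      ∑ m, (∫ x, fderiv ℝ g (co x) (s n (co x)) *
          fderiv ℝ (fun z => fderiv ℝ (fun w => fderiv ℝ g w (s m w)) z (s m z)) (co x) (s n (co x)) ∂ν +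
        ∫ x, fderiv ℝ g (co x) (s n (co x)) * fderiv ℝ ψ (co x) (s m (co x)) *
          fderiv ℝ (fun z => fderiv ℝ g z (s m z)) (co x) (s n (co x)) ∂ν +
        ∫ x, fderiv ℝ g (co x) (s n (co x)) * fderiv ℝ g (co x) (s m (co x)) *
          fderiv ℝ (fun z => fderiv ℝ ψ z (s m z)) (co x) (s n (co x)) ∂ν) := by
    intro n
    have h1 : ∀ x, fderiv ℝ g (co x) (s n (co x)) *
      ∑ m, (fderiv ℝ (fun z => fderiv ℝ (fun w => fderiv ℝ g w (s m w)) z (s m z)) (co x) (s n (co x)) +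
        (fderiv ℝ ψ (co x) (s m (co x)) * fderiv ℝ (fun z => fderiv ℝ g z (s m z)) (co x) (s n (co x)) +
          fderiv ℝ g (co x) (s m (co x)) * fderiv ℝ (fun z => fderiv ℝ ψ z (s m z)) (co x) (s n (co x)))) =
      ∑ m, (fderiv ℝ g (co x) (s n (co x)) *
          fderiv ℝ (fun z => fderiv ℝ (fun w => fderiv ℝ g w (s m w)) z (s m z)) (co x) (s n (co x)) +
        fderiv ℝ g (co x) (s n (co x)) * fderiv ℝ ψ (co x) (s m (co x)) *
          fderiv ℝ (fun z => fderiv ℝ g z (s m z)) (co x) (s n (co x)) +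
        fderiv ℝ g (co x) (s n (co x)) * fderiv ℝ g (co x) (s m (co x)) *
          fderiv ℝ (fun z => fderiv ℝ ψ z (s m z)) (co x) (s n (co x))) := by
      intro x; rw [Finset.mul_sum]; refine Finset.sum_congr rfl fun m _ => ?_; ring
    simp_rw [h1]
    have hI1 : ∀ m, Integrable (fun x => fderiv ℝ g (co x) (s n (co x)) *
        fderiv ℝ (fun z => fderiv ℝ (fun w => fderiv ℝ g w (s m w)) z (s m z)) (co x) (s n (co x))) ν :=
      fun m => hint _ ((cWg n).mul (cWWWg m m n))
    have hI2 : ∀ m, Integrable (fun x => fderiv ℝ g (co x) (s n (co x)) * fderiv ℝ ψ (co x) (s m (co x)) *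
        fderiv ℝ (fun z => fderiv ℝ g z (s m z)) (co x) (s n (co x))) ν :=
      fun m => hint _ (((cWg n).mul (cWψ m)).mul (cWWg m n))
    have hI3 : ∀ m, Integrable (fun x => fderiv ℝ g (co x) (s n (co x)) * fderiv ℝ g (co x) (s m (co x)) *
        fderiv ℝ (fun z => fderiv ℝ ψ z (s m z)) (co x) (s n (co x))) ν :=
      fun m => hint _ (((cWg n).mul (cWg m)).mul (cWWψ m n))
    have hI12 : ∀ m, Integrable (fun x => fderiv ℝ g (co x) (s n (co x)) *
          fderiv ℝ (fun z => fderiv ℝ (fun w => fderiv ℝ g w (s m w)) z (s m z)) (co x) (s n (co x)) +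
        fderiv ℝ g (co x) (s n (co x)) * fderiv ℝ ψ (co x) (s m (co x)) *
          fderiv ℝ (fun z => fderiv ℝ g z (s m z)) (co x) (s n (co x))) ν := fun m => (hI1 m).add (hI2 m)
    have hI123 : ∀ m, Integrable (fun x => fderiv ℝ g (co x) (s n (co x)) *
          fderiv ℝ (fun z => fderiv ℝ (fun w => fderiv ℝ g w (s m w)) z (s m z)) (co x) (s n (co x)) +
        fderiv ℝ g (co x) (s n (co x)) * fderiv ℝ ψ (co x) (s m (co x)) *
          fderiv ℝ (fun z => fderiv ℝ g z (s m z)) (co x) (s n (co x)) +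
        fderiv ℝ g (co x) (s n (co x)) * fderiv ℝ g (co x) (s m (co x)) *
          fderiv ℝ (fun z => fderiv ℝ ψ z (s m z)) (co x) (s n (co x))) ν := fun m => (hI12 m).add (hI3 m)
    rw [integral_finsetSum _ fun m _ => hI123 m]
    refine Finset.sum_congr rfl fun m _ => ?_
    rw [integral_add (hI12 m) (hI3 m), integral_add (hI1 m) (hI2 m)]
  simp_rw [step3]
  -- Step 4: the third-order term.  First Cancellation I moves `W_nW_mW_m` to `W_mW_mW_n` under `Σ_{n,m} ∫`.
  have step4a : ∑ n, ∑ m, ∫ x, fderiv ℝ g (co x) (s n (co x)) *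
      fderiv ℝ (fun z => fderiv ℝ (fun w => fderiv ℝ g w (s m w)) z (s m z)) (co x) (s n (co x)) ∂ν =
      ∑ n, ∑ m, ∫ x, fderiv ℝ g (co x) (s n (co x)) *
      fderiv ℝ (fun z => fderiv ℝ (fun w => fderiv ℝ g w (s n w)) z (s m z)) (co x) (s m (co x)) ∂ν := by
    have hI : ∀ n m, Integrable (fun x => fderiv ℝ g (co x) (s n (co x)) *
        fderiv ℝ (fun z => fderiv ℝ (fun w => fderiv ℝ g w (s m w)) z (s m z)) (co x) (s n (co x))) ν :=
      fun n m => hint _ ((cWg n).mul (cWWWg m m n))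
    have hI' : ∀ n m, Integrable (fun x => fderiv ℝ g (co x) (s n (co x)) *
        fderiv ℝ (fun z => fderiv ℝ (fun w => fderiv ℝ g w (s n w)) z (s m z)) (co x) (s m (co x))) ν :=
      fun n m => hint _ ((cWg n).mul (cWWWg n m m))
    have hS : ∀ n, Integrable (fun x => ∑ m, fderiv ℝ g (co x) (s n (co x)) *
        fderiv ℝ (fun z => fderiv ℝ (fun w => fderiv ℝ g w (s m w)) z (s m z)) (co x) (s n (co x))) ν :=
      fun n => integrable_finsetSum _ fun m _ => hI n m
    have hS' : ∀ n, Integrable (fun x => ∑ m, fderiv ℝ g (co x) (s n (co x)) *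
        fderiv ℝ (fun z => fderiv ℝ (fun w => fderiv ℝ g w (s n w)) z (s m z)) (co x) (s m (co x))) ν :=
      fun n => integrable_finsetSum _ fun m _ => hI' n m
    have hSS : Integrable (fun x => ∑ n, ∑ m, fderiv ℝ g (co x) (s n (co x)) *
        fderiv ℝ (fun z => fderiv ℝ (fun w => fderiv ℝ g w (s m w)) z (s m z)) (co x) (s n (co x))) ν :=
      integrable_finsetSum _ fun n _ => hS n
    have hSS' : Integrable (fun x => ∑ n, ∑ m, fderiv ℝ g (co x) (s n (co x)) *
        fderiv ℝ (fun z => fderiv ℝ (fun w => fderiv ℝ g w (s n w)) z (s m z)) (co x) (s m (co x))) ν :=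
      integrable_finsetSum _ fun n _ => hS' n
    have hL : ∑ n, ∑ m, ∫ x, fderiv ℝ g (co x) (s n (co x)) *
        fderiv ℝ (fun z => fderiv ℝ (fun w => fderiv ℝ g w (s m w)) z (s m z)) (co x) (s n (co x)) ∂ν =
        ∫ x, ∑ n, ∑ m, fderiv ℝ g (co x) (s n (co x)) *
        fderiv ℝ (fun z => fderiv ℝ (fun w => fderiv ℝ g w (s m w)) z (s m z)) (co x) (s n (co x)) ∂ν := by
      rw [integral_finsetSum _ fun n _ => hS n]
      refine Finset.sum_congr rfl fun n _ => ?_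
      rw [integral_finsetSum _ fun m _ => hI n m]
    have hR : ∑ n, ∑ m, ∫ x, fderiv ℝ g (co x) (s n (co x)) *
        fderiv ℝ (fun z => fderiv ℝ (fun w => fderiv ℝ g w (s n w)) z (s m z)) (co x) (s m (co x)) ∂ν =
        ∫ x, ∑ n, ∑ m, fderiv ℝ g (co x) (s n (co x)) *
        fderiv ℝ (fun z => fderiv ℝ (fun w => fderiv ℝ g w (s n w)) z (s m z)) (co x) (s m (co x)) ∂ν := by
      rw [integral_finsetSum _ fun n _ => hS' n]
      refine Finset.sum_congr rfl fun n _ => ?_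
      rw [integral_finsetSum _ fun m _ => hI' n m]
    rw [hL, hR, ← sub_eq_zero, ← integral_sub hSS hSS']
    refine integral_eq_zero_of_ae (Filter.Eventually.of_forall fun x => ?_)
    have h := sum_sum_frameDeriv_mul_comm_sq_eq_zero hg s c hs hc (co x)
    simp only [Pi.zero_apply]
    rw [← Finset.sum_sub_distrib]
    simp_rw [← Finset.sum_sub_distrib, ← mul_sub]
    exact h
  -- then integrate by parts once: `∫ W_ng · W_m(W_mW_ng) = -∫ (W_mW_ng)² - ∫ (W_mW_ng) W_ng W_mψ`
  have step4b : ∀ n m, ∫ x, fderiv ℝ g (co x) (s n (co x)) *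
      fderiv ℝ (fun z => fderiv ℝ (fun w => fderiv ℝ g w (s n w)) z (s m z)) (co x) (s m (co x)) ∂ν =
      -∫ x, (fderiv ℝ (fun z => fderiv ℝ g z (s n z)) (co x) (s m (co x))) ^ 2 ∂ν -
        ∫ x, fderiv ℝ (fun z => fderiv ℝ g z (s n z)) (co x) (s m (co x)) * fderiv ℝ g (co x) (s n (co x)) *
          fderiv ℝ ψ (co x) (s m (co x)) ∂ν := by
    intro n m
    have h := hIBP m (fun z => fderiv ℝ (fun w => fderiv ℝ g w (s n w)) z (s m z)) (fun z => fderiv ℝ g z (s n z))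
      (hWWg1 n m) ((hWg2 n).of_le (by norm_num))
    beta_reduce at h
    have hl : ∫ x, fderiv ℝ g (co x) (s n (co x)) *
        fderiv ℝ (fun z => fderiv ℝ (fun w => fderiv ℝ g w (s n w)) z (s m z)) (co x) (s m (co x)) ∂ν =
        ∫ x, fderiv ℝ (fun z => fderiv ℝ (fun w => fderiv ℝ g w (s n w)) z (s m z)) (co x) (s m (co x)) *
          fderiv ℝ g (co x) (s n (co x)) ∂ν := by
      refine integral_congr_ae (Filter.Eventually.of_forall fun x => ?_); simp only [mul_comm]
    have e1 : ∫ x, fderiv ℝ (fun w => fderiv ℝ g w (s n w)) (co x) (s m (co x)) *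
        fderiv ℝ (fun z => fderiv ℝ g z (s n z)) (co x) (s m (co x)) ∂ν =
        ∫ x, (fderiv ℝ (fun z => fderiv ℝ g z (s n z)) (co x) (s m (co x))) ^ 2 ∂ν :=
      integral_congr_ae (Filter.Eventually.of_forall fun x => by simp only [sq])
    rw [hl, h, e1]
  -- Step 5: Cancellation II kills the two drift cross terms.
  have step5 : ∑ n, ∑ m, (∫ x, fderiv ℝ g (co x) (s n (co x)) * fderiv ℝ ψ (co x) (s m (co x)) *
      fderiv ℝ (fun z => fderiv ℝ g z (s m z)) (co x) (s n (co x)) ∂ν -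
      ∫ x, fderiv ℝ (fun z => fderiv ℝ g z (s n z)) (co x) (s m (co x)) * fderiv ℝ g (co x) (s n (co x)) *
          fderiv ℝ ψ (co x) (s m (co x)) ∂ν) = 0 := by
    have hI2 : ∀ n m, Integrable (fun x => fderiv ℝ g (co x) (s n (co x)) * fderiv ℝ ψ (co x) (s m (co x)) *
        fderiv ℝ (fun z => fderiv ℝ g z (s m z)) (co x) (s n (co x))) ν :=
      fun n m => hint _ (((cWg n).mul (cWψ m)).mul (cWWg m n))
    have hI4 : ∀ n m, Integrable (fun x => fderiv ℝ (fun z => fderiv ℝ g z (s n z)) (co x) (s m (co x)) *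
        fderiv ℝ g (co x) (s n (co x)) * fderiv ℝ ψ (co x) (s m (co x))) ν :=
      fun n m => hint _ (((cWWg n m).mul (cWg n)).mul (cWψ m))
    have hI24 : ∀ n m, Integrable (fun x => fderiv ℝ g (co x) (s n (co x)) * fderiv ℝ ψ (co x) (s m (co x)) *
        fderiv ℝ (fun z => fderiv ℝ g z (s m z)) (co x) (s n (co x)) -
        fderiv ℝ (fun z => fderiv ℝ g z (s n z)) (co x) (s m (co x)) *
        fderiv ℝ g (co x) (s n (co x)) * fderiv ℝ ψ (co x) (s m (co x))) ν := fun n m => (hI2 n m).sub (hI4 n m)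
    have hS : ∀ n, Integrable (fun x => ∑ m, (fderiv ℝ g (co x) (s n (co x)) * fderiv ℝ ψ (co x) (s m (co x)) *
        fderiv ℝ (fun z => fderiv ℝ g z (s m z)) (co x) (s n (co x)) -
        fderiv ℝ (fun z => fderiv ℝ g z (s n z)) (co x) (s m (co x)) *
        fderiv ℝ g (co x) (s n (co x)) * fderiv ℝ ψ (co x) (s m (co x)))) ν :=
      fun n => integrable_finsetSum _ fun m _ => hI24 n m
    have hre : ∀ n m, (∫ x, fderiv ℝ g (co x) (s n (co x)) * fderiv ℝ ψ (co x) (s m (co x)) *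
      fderiv ℝ (fun z => fderiv ℝ g z (s m z)) (co x) (s n (co x)) ∂ν -
      ∫ x, fderiv ℝ (fun z => fderiv ℝ g z (s n z)) (co x) (s m (co x)) * fderiv ℝ g (co x) (s n (co x)) *
          fderiv ℝ ψ (co x) (s m (co x)) ∂ν) = ∫ x, (fderiv ℝ g (co x) (s n (co x)) * fderiv ℝ ψ (co x) (s m (co x)) *
        fderiv ℝ (fun z => fderiv ℝ g z (s m z)) (co x) (s n (co x)) -
        fderiv ℝ (fun z => fderiv ℝ g z (s n z)) (co x) (s m (co x)) *
        fderiv ℝ g (co x) (s n (co x)) * fderiv ℝ ψ (co x) (s m (co x))) ∂ν :=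
      fun n m => (integral_sub (hI2 n m) (hI4 n m)).symm
    simp_rw [hre]
    have hL : ∑ n, ∑ m, ∫ x, (fderiv ℝ g (co x) (s n (co x)) * fderiv ℝ ψ (co x) (s m (co x)) *
        fderiv ℝ (fun z => fderiv ℝ g z (s m z)) (co x) (s n (co x)) -
        fderiv ℝ (fun z => fderiv ℝ g z (s n z)) (co x) (s m (co x)) *
        fderiv ℝ g (co x) (s n (co x)) * fderiv ℝ ψ (co x) (s m (co x))) ∂ν =
        ∫ x, ∑ n, ∑ m, (fderiv ℝ g (co x) (s n (co x)) * fderiv ℝ ψ (co x) (s m (co x)) *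
        fderiv ℝ (fun z => fderiv ℝ g z (s m z)) (co x) (s n (co x)) -
        fderiv ℝ (fun z => fderiv ℝ g z (s n z)) (co x) (s m (co x)) *
        fderiv ℝ g (co x) (s n (co x)) * fderiv ℝ ψ (co x) (s m (co x))) ∂ν := by
      rw [integral_finsetSum _ fun n _ => hS n]
      refine Finset.sum_congr rfl fun n _ => ?_
      rw [integral_finsetSum _ fun m _ => hI24 n m]
    rw [hL]
    refine integral_eq_zero_of_ae (Filter.Eventually.of_forall fun x => ?_)
    have h := sum_sum_frameDeriv_mul_mul_comm_eq_zero (ψ := ψ) hg2 s c hs hc (co x)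
    simp only [Pi.zero_apply]
    rw [show (∑ n, ∑ m, (fderiv ℝ g (co x) (s n (co x)) * fderiv ℝ ψ (co x) (s m (co x)) *
        fderiv ℝ (fun z => fderiv ℝ g z (s m z)) (co x) (s n (co x)) -
        fderiv ℝ (fun z => fderiv ℝ g z (s n z)) (co x) (s m (co x)) *
        fderiv ℝ g (co x) (s n (co x)) * fderiv ℝ ψ (co x) (s m (co x)))) =
        -(∑ n, ∑ m, fderiv ℝ g (co x) (s n (co x)) * fderiv ℝ ψ (co x) (s m (co x)) *
          (fderiv ℝ (fun z => fderiv ℝ g z (s n z)) (co x) (s m (co x)) -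
            fderiv ℝ (fun z => fderiv ℝ g z (s m z)) (co x) (s n (co x)))) from by
      rw [← Finset.sum_neg_distrib]
      refine Finset.sum_congr rfl fun n _ => ?_
      rw [← Finset.sum_neg_distrib]
      refine Finset.sum_congr rfl fun m _ => ?_
      ring]
    rw [h, neg_zero]
  -- assemble
  simp_rw [step4b] at step4a
  simp only [Finset.sum_add_distrib, Finset.sum_sub_distrib, Finset.sum_neg_distrib] at step4a step5 ⊢
  rw [step4a]
  linarith
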